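import Literature.Probability.Independence.HoeffdingDecompositionTransport
import Literature.MathematicalPhysics.QuantumFieldTheory.StrongCouplingActivities
import HarnessLib

/-!
# Route `FlatTubeReduction`, crux `PinnedUnitStepEx` (stmt-QuantumFields-27561), stub `stub_smearVarPosGS1` — PP-a: shear invariance of product Haar measure

Seat ym-line-fcl-p3 g9 (2026-08-28).  Blueprint (file «PP», partial products): on a finite product `ι → G` of copies of the Haar probability
measure of a compact group, the SHEAR `x ↦ x[b ↦ x_a · x_b]` (`a ≠ b`) preserves the product measure (`measurePreserving_update_mul_left`; right
version `measurePreserving_update_mul_right`).  Proof without any product-splitting equivalence: integrate the coordinate `b` out first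
(`Hoeffding.condAvg_singleton`, `Hoeffding.integral_condAvg`) and use left/right invariance of the one-coordinate Haar integral
(`integral_mul_left_eq_self` / `integral_mul_right_eq_self`, `haarProbability.instIsMulRightInvariant`); measures are compared on indicators.
Iterating shears along a chain of distinct coordinates turns link variables into PARTIAL PRODUCTS (memo §P6), the change of variables that feeds
the omission lemma (`…PinnedUnitStepExOmission`).  R2b1 RECORD rung; no summit/crux/stub here.
-/

set_option autoImplicit false

noncomputable section

namespace Summit.QuantumFields.YangMills.Theorems.FlatTubeReduction.Decimation

open MeasureTheory Finset Function
open Literature.MathematicalPhysics.QuantumFieldTheory (haarProbability)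
open Literature.Probability.Independence.Hoeffding

variable {ι : Type*} [Fintype ι] [DecidableEq ι]
variable {G : Type*} [Group G] [TopologicalSpace G] [IsTopologicalGroup G] [CompactSpace G] [MeasurableSpace G] [BorelSpace G]
  [SecondCountableTopology G]

omit [Fintype ι] [CompactSpace G] in
/-- The left shear `x ↦ x[b ↦ x_a x_b]` is measurable. [folklore] -/
theorem measurable_update_mul_left (a b : ι) : Measurable fun x : ι → G => Function.update x b (x a * x b) := by
  refine measurable_pi_iff.2 fun i => ?_
  by_cases hi : i = b
  · subst hi
    simp only [Function.update_self]
    exact (measurable_pi_apply a).mul (measurable_pi_apply i)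
  · simp only [Function.update_of_ne hi]
    exact measurable_pi_apply i

/-- **Integrals are shear invariant**: `∫ F(x[b ↦ x_a x_b]) = ∫ F` for bounded measurable `F` and `a ≠ b` (integrate `x_b` out first; left
invariance of Haar). [folklore] -/
theorem integral_comp_update_mul_left {a b : ι} (hab : a ≠ b) {F : (ι → G) → ℝ} (hF : Measurable F) {C : ℝ} (hC : ∀ x, |F x| ≤ C) :
    ∫ x, F (Function.update x b (x a * x b)) ∂(Measure.pi fun _ : ι => haarProbability G) =
      ∫ x, F x ∂(Measure.pi fun _ : ι => haarProbability G) := by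
  set μ := haarProbability G with hμ
  have hFT : Measurable fun x : ι → G => F (Function.update x b (x a * x b)) := hF.comp (measurable_update_mul_left a b)
  have hCT : ∀ x : ι → G, |F (Function.update x b (x a * x b))| ≤ C := fun x => hC _
  -- `E_{b}` of the sheared function is `E_{b}` of `F`
  have hE : condAvg μ {b} (fun x : ι → G => F (Function.update x b (x a * x b))) = condAvg μ {b} F := by
    rw [condAvg_singleton, condAvg_singleton]
    funext x
    have h1 : ∀ y : G, Function.update (Function.update x b y) b (Function.update x b y a * Function.update x b y b) =
        Function.update x b (x a * y) := fun y => by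
      rw [Function.update_idem, Function.update_of_ne hab, Function.update_self]
    simp only [h1]
    exact integral_mul_left_eq_self (μ := μ) (fun y => F (Function.update x b y)) (x a)
  rw [← integral_condAvg {b} hFT hCT, hE, integral_condAvg {b} hF hC]

/-- ★ **The left shear preserves the product Haar measure.** [folklore] -/
theorem measurePreserving_update_mul_left {a b : ι} (hab : a ≠ b) :
    MeasurePreserving (fun x : ι → G => Function.update x b (x a * x b))
      (Measure.pi fun _ : ι => haarProbability G) (Measure.pi fun _ : ι => haarProbability G) := by
  set P := Measure.pi fun _ : ι => haarProbability G with hP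
  refine ⟨measurable_update_mul_left a b, Measure.ext fun s hs => ?_⟩
  rw [Measure.map_apply (measurable_update_mul_left a b) hs]
  have hind : Measurable (s.indicator (1 : (ι → G) → ℝ)) := measurable_one.indicator hs
  have hbd : ∀ x, |s.indicator (1 : (ι → G) → ℝ) x| ≤ 1 := fun x => by
    by_cases hx : x ∈ s <;> simp [Set.indicator, hx]
  have h := integral_comp_update_mul_left (G := G) hab hind hbd
  have hpre : ∀ x : ι → G, s.indicator (1 : (ι → G) → ℝ) (Function.update x b (x a * x b)) =
      ((fun x : ι → G => Function.update x b (x a * x b)) ⁻¹' s).indicator 1 x := fun x => by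
    simp only [Set.indicator, Set.mem_preimage]; rfl
  simp only [hpre] at h
  rw [integral_indicator_one ((measurable_update_mul_left a b) hs), integral_indicator_one hs] at h
  have h1 : P ((fun x : ι → G => Function.update x b (x a * x b)) ⁻¹' s) ≠ ⊤ := measure_ne_top _ _
  have h2 : P s ≠ ⊤ := measure_ne_top _ _
  exact (ENNReal.toReal_eq_toReal_iff' h1 h2).1 h

/-- Integrals are invariant under the right shear `x ↦ x[b ↦ x_b x_a]` (right invariance of Haar on a compact group). [folklore] -/
theorem integral_comp_update_mul_right {a b : ι} (hab : a ≠ b) {F : (ι → G) → ℝ} (hF : Measurable F) {C : ℝ} (hC : ∀ x, |F x| ≤ C) :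
    ∫ x, F (Function.update x b (x b * x a)) ∂(Measure.pi fun _ : ι => haarProbability G) =
      ∫ x, F x ∂(Measure.pi fun _ : ι => haarProbability G) := by
  set μ := haarProbability G with hμ
  have hT : Measurable fun x : ι → G => Function.update x b (x b * x a) := by
    refine measurable_pi_iff.2 fun i => ?_
    by_cases hi : i = b
    · subst hi; simp only [Function.update_self]; exact (measurable_pi_apply i).mul (measurable_pi_apply a)
    · simp only [Function.update_of_ne hi]; exact measurable_pi_apply i
  have hFT : Measurable fun x : ι → G => F (Function.update x b (x b * x a)) := hF.comp hT
  have hCT : ∀ x : ι → G, |F (Function.update x b (x b * x a))| ≤ C := fun x => hC _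
  have hE : condAvg μ {b} (fun x : ι → G => F (Function.update x b (x b * x a))) = condAvg μ {b} F := by
    rw [condAvg_singleton, condAvg_singleton]
    funext x
    have h1 : ∀ y : G, Function.update (Function.update x b y) b (Function.update x b y b * Function.update x b y a) =
        Function.update x b (y * x a) := fun y => by
      rw [Function.update_idem, Function.update_of_ne hab, Function.update_self]
    simp only [h1]
    exact integral_mul_right_eq_self (μ := μ) (fun y => F (Function.update x b y)) (x a)
  rw [← integral_condAvg {b} hFT hCT, hE, integral_condAvg {b} hF hC]

end Summit.QuantumFields.YangMills.Theorems.FlatTubeReduction.Decimation
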